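import Summits.HubbardSuperconductivity.HubbardSuperconductivity.Theses.FixedNodeShadow

/-!
# Route `FixedNodeShadow` — glue support `FnTargetOfAnchorRelease` (stmt-HubbardSuperconductivity-14223)

`FnTargetOfAnchorRelease : FnAnchorOrder → FnNodeRelease → FnTarget` — ANCHOR and RELEASE imply
the node-release path statement. Pure logic: the anchor supplies `(U, δ, φ, a)` and the body that
is literally the hypothesis of the release; the release returns `(a', L₁)` and the path statement,
which is the body of `FnTarget` at `(U, δ, φ)`. (The same three lines open the route's deciding
theorem `closes`.) No analysis, no new definitions. Sources of the setting: ten Haaf et al.,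
Phys. Rev. B 51 (1995) 13039; Sorella–Capriotti, Phys. Rev. B 61 (2000) 2599 (fixed-node /
lattice Green-function Monte Carlo) — nothing from them is used.
-/

-- the mandated namespace `Summit.<Summit>.<Problem>.Theorems` repeats `HubbardSuperconductivity`
-- (single-problem summit, D-0017), which the `dupNamespace` linter flags on every declaration
set_option linter.dupNamespace false

namespace Summit.HubbardSuperconductivity.HubbardSuperconductivity.Theorems

/-- **FnTargetOfAnchorRelease** (item `stmt-HubbardSuperconductivity-14223`):
`FnAnchorOrder → FnNodeRelease → FnTarget` — feed the anchor's data and body to the release and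
repackage its output. [folklore] -/
theorem fnTargetOfAnchorRelease_proof :
    Summit.HubbardSuperconductivity.HubbardSuperconductivity.Theses.FixedNodeShadow.FnTargetOfAnchorRelease := by
  unfold Summit.HubbardSuperconductivity.HubbardSuperconductivity.Theses.FixedNodeShadow.FnTargetOfAnchorRelease
    Summit.HubbardSuperconductivity.HubbardSuperconductivity.Theses.FixedNodeShadow.FnAnchorOrder
    Summit.HubbardSuperconductivity.HubbardSuperconductivity.Theses.FixedNodeShadow.FnNodeRelease
    Summit.HubbardSuperconductivity.HubbardSuperconductivity.Theses.FixedNodeShadow.FnTarget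
  rintro ⟨U, hU, δ, hδ, φ, a, ha, hbody⟩ hR
  obtain ⟨a', ha', L₁, hpath⟩ := hR U δ φ a hU hδ ha hbody
  exact ⟨U, hU, δ, hδ, φ, a', ha', L₁, hpath⟩

end Summit.HubbardSuperconductivity.HubbardSuperconductivity.Theorems
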